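import Summits.BirchSwinnertonDyer.BirchSwinnertonDyer.Theorems.GoldfeldAllTwistsTwoConverseTwinAdditiveTwoAdicPlusPFiveEven
import Summits.BirchSwinnertonDyer.BirchSwinnertonDyer.Theorems.GoldfeldAllTwistsTwoConverseTwinAdditiveTwoPrimesTwistSelmer
import HarnessLib

set_option linter.dupNamespace false -- namespace `…BirchSwinnertonDyer.BirchSwinnertonDyer…` is the cell's (D-0017 nested layout)
set_option autoImplicit false

/-!
# B5⁺ tranche F_β⁺, file Fβ⁺-1: the SHARP Selmer set `S(−42qp, 448q²p²) ⊆ {1, 7}` of `W = 49a1^{(−2qp)}` for `q ≡ 7 (8)`, `(q/7) = −1`, `p ≡ 5 (8)`,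
# `(−7/p) = 1` — TYPE-FREE AND `(p/q)`-FREE (serves b75+ and a75+, C4 and C8 alike), FACT-FREE

Cell `bsd-goldfeld`, seat `bsd-goldfeld-s1p-c3x` (gen 16); planner ORDER (cccxciii) «OBJECT B5⁺», tranche F_β⁺ (kill table `scoping/kills_b75_plus.txt`:
on b75+ ALL four `p`-classes `p, 2p, 7p, 14p` of `S(W)` die at `2`). TWIN of D⁺-6 `…TwinAdditiveTwoPrimesTwistSelmerPlusPFiveAlpha` (a75+, type α) with
the two `p`-adic type-α kills of `2p, 14p` REPLACED by the `2`-adic kills of Fβ⁺-0a (`not_isSoluble_two_class_twoP_plusPFive`,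
`not_isSoluble_two_class_fourteenP_plusPFive`); consequently the binders `hα` AND `hpq` disappear: negatives at `ℝ`, the `q`-classes at `q` (`(−7/q) = −1`),
`2, 14` at `p` (`(2/p) = −1`), `p, 2p, 7p, 14p` at `2` (`(q, p) ≡ (7, 5) (mod 8)`). `--supports stmt-BirchSwinnertonDyer-19140` as a HELPER. Theses-free;
theorems only; no definition, no fact binder, no `sorry`. FRONTIER-grade: a twist-density-ZERO sub-family; never distance-to-summit.
HONEST FRAMING: a Selmer bound; no `BSD(W,2)` is proved here; items 19140 / 19350 / 20044 unchanged; BSD is not proved by any of this.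

References: [SilvermanAEC2009] Prop. X.4.9, Example X.4.10; [Serre1973] Ch. II §3.3 Thm 4.
-/

noncomputable section

open scoped Classical

open WeierstrassCurve Literature.NumberTheory.EllipticCurves

namespace Summit.BirchSwinnertonDyer.BirchSwinnertonDyer.Theorems.GoldfeldGoodTwists

/-! ## §1 Two arithmetic helpers -/


section LocalPFive
variable {q p : ℕ} [Fact q.Prime] [Fact p.Prime]

/-- A natural number not divisible by the prime `ℓ` is non-zero in `ZMod ℓ`, as an integer cast. [folklore] -/
private theorem intCast_ne_zero_of_not_dvd_pFiveTwoAdic {l : ℕ} [Fact l.Prime] {n : ℕ} (h : ¬ l ∣ n) : ((n : ℤ) : ZMod l) ≠ 0 := by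
  rw [Int.cast_natCast, Ne, ZMod.natCast_eq_zero_iff]; exact h

/-- A prime `ℓ ≠ 2, 7` divides no `2^a·7^b`. [folklore] -/
private theorem not_dvd_two_pow_mul_seven_pow_pFiveTwoAdic {l : ℕ} (hl : l.Prime) (hl2 : l ≠ 2) (hl7 : l ≠ 7) (a b : ℕ) :
    ¬ l ∣ 2 ^ a * 7 ^ b := by
  intro h
  rcases (Nat.Prime.dvd_mul hl).mp h with h | h
  · exact hl2 ((Nat.prime_dvd_prime_iff_eq hl Nat.prime_two).mp (hl.dvd_of_dvd_pow h))
  · exact hl7 ((Nat.prime_dvd_prime_iff_eq hl (by norm_num)).mp (hl.dvd_of_dvd_pow h))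

end LocalPFive

/-! ## §2 `S(−42qp, 448q²p²) ⊆ {1, 7}` for `(q, p) ≡ (7, 5) (mod 8)`, `(q/7) = −1`, `(−7/p) = 1` — any type, any `(p/q)` -/

section SelmerSPFive
variable {q p : ℕ} [Fact q.Prime] [Fact p.Prime]

set_option maxHeartbeats 400000 in -- sixteen positive classes, each with its local computation (as the source D⁺-6)
/-- **`S(−42qp, 448q²p²) ⊆ {1, 7}`** for `q ≡ 7 (8)`, `(q/7) = −1`, `p ≡ 5 (8)`, `(−7/p) = 1` — no type condition, no `(p/q)` condition
(cells a75+, b75+, C4, C8): negatives at `ℝ`, the `q`-classes at `q`, `2, 14` at `p`, `p, 2p, 7p, 14p` at `2`. [cite: SilvermanAEC2009, Prop. X.4.9 and Example X.4.10] -/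
theorem twoIsogenySelmerGroup_twoPrimesTwist_subset_pair_pFiveTwoAdic (hq8 : q % 8 = 7) (hq7 : jacobiSym q 7 = -1) (hp8 : p % 8 = 5)
    (hp7 : legendreSym p (-7) = 1) :
    twoIsogenySelmerGroup (-42 * ((q : ℤ) * p)) (448 * ((q : ℤ) * p) ^ 2) ⊆ ({1, 7} : Finset ℤ) := by
  have hq : q.Prime := Fact.out
  have hp : p.Prime := Fact.out
  have hqZ : Prime (q : ℤ) := Nat.prime_iff_prime_int.mp hq
  have hpZ : Prime (p : ℤ) := Nat.prime_iff_prime_int.mp hp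
  have hq0 : (q : ℤ) ≠ 0 := by exact_mod_cast hq.ne_zero
  have hp0 : (p : ℤ) ≠ 0 := by exact_mod_cast hp.ne_zero
  have hq4 : q % 4 = 3 := by omega
  have hp4 : p % 4 = 1 := by omega
  have hq2 : q ≠ 2 := by rintro rfl; norm_num at hq4
  have hp2 : p ≠ 2 := by rintro rfl; norm_num at hp4
  have hqp : q ≠ p := by rintro rfl; omega
  have hq7' : q ≠ 7 := by
    rintro rfl; rw [jacobiSym.mod_left] at hq7; norm_num at hq7
  have hp7' : p ≠ 7 := by rintro rfl; norm_num at hp4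
  obtain ⟨-, hm7q⟩ := legendreSym_seven_and_neg_seven_of_three_mod_four hq4 hq7
  obtain ⟨h2p, h7p, -⟩ := legendreSym_two_seven_neg_one_of_five_mod_eight hp8 hp7
  -- non-vanishing modulo `q` and `p`
  have hcq : ∀ a b : ℕ, (((2 ^ a * 7 ^ b : ℕ) : ℤ) : ZMod q) ≠ 0 := fun a b ↦
    intCast_ne_zero_of_not_dvd_pFiveTwoAdic (not_dvd_two_pow_mul_seven_pow_pFiveTwoAdic hq hq2 hq7' a b)
  have hcp : ∀ a b : ℕ, (((2 ^ a * 7 ^ b : ℕ) : ℤ) : ZMod p) ≠ 0 := fun a b ↦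
    intCast_ne_zero_of_not_dvd_pFiveTwoAdic (not_dvd_two_pow_mul_seven_pow_pFiveTwoAdic hp hp2 hp7' a b)
  have hpq0 : (p : ZMod q) ≠ 0 := by
    have := intCast_ne_zero_of_not_dvd_pFiveTwoAdic (l := q) (fun h ↦ hqp ((Nat.prime_dvd_prime_iff_eq hq hp).mp h)); exact_mod_cast this
  have hqp0 : ((q : ℤ) : ZMod p) ≠ 0 :=
    intCast_ne_zero_of_not_dvd_pFiveTwoAdic (l := p) (fun h ↦ hqp ((Nat.prime_dvd_prime_iff_eq hp hq).mp h).symm)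
  have h2pq : ((2 * p : ℤ) : ZMod q) ≠ 0 := by
    have h2 := hcq 1 0; norm_num at h2; push_cast; exact mul_ne_zero (by exact_mod_cast h2) hpq0
  have hns_disc_q : ¬ IsSquare ((((-42 * p) ^ 2 - 4 * (448 * p ^ 2) : ℤ)) : ZMod q) := by
    rw [show ((-42 * p) ^ 2 - 4 * (448 * p ^ 2) : ℤ) = -7 * (2 * p) ^ 2 by ring]
    exact not_isSquare_mul_sq_zmod h2pq ((legendreSym.eq_neg_one_iff q).mp hm7q)
  -- residues modulo `p`: `q`, `7` squares; `2`, `14`, `2q`, `14q` non-squares; non-vanishings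
  have h2p0 : ((2 : ℤ) : ZMod p) ≠ 0 := by have := hcp 1 0; norm_num at this; exact_mod_cast this
  have h4qp : ((4 * q : ℤ) : ZMod p) ≠ 0 := by
    have h4 := hcp 2 0; norm_num at h4; push_cast; exact mul_ne_zero (by exact_mod_cast h4) (by exact_mod_cast hqp0)
  have hns_2_p : ¬ IsSquare (((2 : ℤ)) : ZMod p) := (legendreSym.eq_neg_one_iff p).mp h2p
  have hns_14_p : ¬ IsSquare (((14 : ℤ)) : ZMod p) :=
    (legendreSym.eq_neg_one_iff p).mp (by rw [show (14 : ℤ) = 2 * 7 by norm_num, legendreSym.mul, h2p, h7p]; norm_num)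
  have hns_224qq_p : ¬ IsSquare (((224 * q ^ 2 : ℤ)) : ZMod p) := by
    rw [show (224 * q ^ 2 : ℤ) = 14 * (4 * q) ^ 2 by ring]; exact not_isSquare_mul_sq_zmod h4qp hns_14_p
  have hns_32qq_p : ¬ IsSquare (((32 * q ^ 2 : ℤ)) : ZMod p) := by
    rw [show (32 * q ^ 2 : ℤ) = 2 * (4 * q) ^ 2 by ring]; exact not_isSquare_mul_sq_zmod h4qp hns_2_p
  have hb : (448 * ((q : ℤ) * p) ^ 2 : ℤ) ≠ 0 := by positivity
  intro d hd
  rw [mem_twoIsogenySelmerGroup_iff hb] at hd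
  obtain ⟨hsqf, ⟨d', hdd'⟩, hloc⟩ := hd
  have hd'eq : (448 * ((q : ℤ) * p) ^ 2 : ℤ) / d = d' := by rw [hdd', Int.mul_ediv_cancel_left _ hsqf.ne_zero]
  rw [hd'eq] at hloc
  obtain ⟨hreal, hpadic⟩ := hloc
  -- negatives die at `ℝ`
  have hdpos : 0 < d := by
    rcases lt_or_gt_of_ne hsqf.ne_zero with hneg | hpos
    · exfalso
      have hbpos : (0 : ℤ) < 448 * ((q : ℤ) * p) ^ 2 := by positivity
      have hd'neg : d' < 0 := by
        by_contra hcon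
        nlinarith [mul_nonpos_iff.mpr (Or.inr ⟨hneg.le, le_of_not_gt hcon⟩)]
      have ha : (-42 * ((q : ℤ) * p)) ≤ 0 := by
        have : (0 : ℤ) ≤ (q : ℤ) * p := by positivity
        linarith
      exact not_isSoluble_real_twoIsogenyQuartic_of_neg hneg hd'neg ha hreal
    · exact hpos
  -- the `q`-classes die at `q`
  have hqd : ¬ (q : ℤ) ∣ d := by
    rintro ⟨e, rfl⟩
    have h1 : e * d' = 448 * q * p ^ 2 := mul_left_cancel₀ hq0 (by linear_combination (-1 : ℤ) * hdd')
    have h3 : (q : ℤ) ∣ e * d' := ⟨448 * p ^ 2, by rw [h1]; ring⟩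
    rcases hqZ.dvd_or_dvd h3 with h4 | h4
    · obtain ⟨e₁, rfl⟩ := h4
      exact hqZ.not_unit (hsqf (q : ℤ) ⟨e₁, by ring⟩)
    · obtain ⟨e', rfl⟩ := h4
      have hm : e * e' = 448 * p ^ 2 := mul_left_cancel₀ hq0 (by linear_combination h1)
      exact not_isSoluble_padic_of_prime_dvd_coeffs (p := q) (c := -42 * p) (by ring) rfl rfl hm hns_disc_q (hpadic q)
  -- `d ∣ 14qp` prime to `q`: `d ∣ 14p`
  have h0 : d ∣ 448 * ((q : ℤ) * p) ^ 2 := ⟨d', hdd'⟩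
  have h1 : d ∣ (14 * ((q : ℤ) * p)) ^ 6 := h0.trans ⟨16807 * ((q : ℤ) * p) ^ 4, by ring⟩
  have h14qp : d ∣ 14 * ((q : ℤ) * p) := (hsqf.dvd_pow_iff_dvd (by norm_num)).mp h1
  have hcopq : IsCoprime d (q : ℤ) := ((hqZ.irreducible.coprime_iff_not_dvd).mpr hqd).symm
  have h14p : d ∣ 14 * (p : ℤ) := by
    have : d ∣ (q : ℤ) * (14 * p) := by rw [show (q : ℤ) * (14 * p) = 14 * (q * p) by ring]; exact h14qp
    exact hcopq.dvd_of_dvd_mul_left this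
  by_cases hpd : (p : ℤ) ∣ d
  · -- `d = p·e`, `e ∣ 14`: all four die at `2`
    exfalso
    obtain ⟨e, rfl⟩ := hpd
    have he14 : e ∣ 14 := by
      have : (p : ℤ) * e ∣ (p : ℤ) * 14 := by rw [mul_comm (p : ℤ) 14]; exact h14p
      exact (mul_dvd_mul_iff_left hp0).mp this
    have hepos : 0 < e := pos_of_mul_pos_right hdpos (by positivity)
    have hele : e ≤ 14 := Int.le_of_dvd (by norm_num) he14
    have hd'e : e * d' = 448 * q ^ 2 * p := mul_left_cancel₀ hp0 (by linear_combination (-1 : ℤ) * hdd')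
    interval_cases e <;> try omega
    · -- `d = p`: dies at `2` (D⁺-0′)
      exact not_isSoluble_two_class_P_plusPFive hq8 hp8 rfl rfl
        (show d' = (p : ℤ) * (448 * (q : ℤ) ^ 2) by linarith) (hpadic 2)
    · -- `d = 2p`: dies at `2` (Fβ⁺-0a)
      exact not_isSoluble_two_class_twoP_plusPFive hq8 hp8 rfl rfl
        (show d' = (p : ℤ) * (224 * (q : ℤ) ^ 2) by linarith) (hpadic 2)
    · -- `d = 7p`: dies at `2` (D⁺-0′)
      exact not_isSoluble_two_class_sevenP_plusPFive hq8 hp8 rfl rfl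
        (show d' = (p : ℤ) * (64 * (q : ℤ) ^ 2) by linarith) (hpadic 2)
    · -- `d = 14p`: dies at `2` (Fβ⁺-0a)
      exact not_isSoluble_two_class_fourteenP_plusPFive hq8 hp8 rfl rfl
        (show d' = (p : ℤ) * (32 * (q : ℤ) ^ 2) by linarith) (hpadic 2)
  · -- `d ∣ 14`, `d > 0`: `2, 14` die at `p` (`(2/p) = −1`)
    have hcopp : IsCoprime d (p : ℤ) := ((hpZ.irreducible.coprime_iff_not_dvd).mpr hpd).symm
    have hd14 : d ∣ 14 := hcopp.dvd_of_dvd_mul_right h14p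
    have hle : d ≤ 14 := Int.le_of_dvd (by norm_num) hd14
    simp only [Finset.mem_insert, Finset.mem_singleton]
    interval_cases d <;> try omega
    · exact absurd (hpadic p) (not_isSoluble_padic_of_nonresidue_of_sq_dvd (p := p) (c := -42 * q) (e' := 224 * q ^ 2) (by ring)
        (show d' = (p : ℤ) ^ 2 * (224 * q ^ 2) by linarith) hns_2_p hns_224qq_p)
    · exact absurd (hpadic p) (not_isSoluble_padic_of_nonresidue_of_sq_dvd (p := p) (c := -42 * q) (e' := 32 * q ^ 2) (by ring)
        (show d' = (p : ℤ) ^ 2 * (32 * q ^ 2) by linarith) hns_14_p hns_32qq_p)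

/-- **`#S(−42qp, 448q²p²) ≤ 2`** for `(q, p) ≡ (7, 5) (mod 8)`, `(q/7) = −1`, `(−7/p) = 1` (sharp). [cite: SilvermanAEC2009, Prop. X.4.9 and Example X.4.10] -/
theorem card_twoIsogenySelmerGroup_twoPrimesTwist_le_two_pFiveTwoAdic (hq8 : q % 8 = 7) (hq7 : jacobiSym q 7 = -1) (hp8 : p % 8 = 5)
    (hp7 : legendreSym p (-7) = 1) :
    (twoIsogenySelmerGroup (-42 * ((q : ℤ) * p)) (448 * ((q : ℤ) * p) ^ 2)).card ≤ 2 :=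
  (Finset.card_le_card (twoIsogenySelmerGroup_twoPrimesTwist_subset_pair_pFiveTwoAdic hq8 hq7 hp8 hp7)).trans Finset.card_le_two

end SelmerSPFive

end Summit.BirchSwinnertonDyer.BirchSwinnertonDyer.Theorems.GoldfeldGoodTwists

end
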